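import Summits.AtomisticToContinuum.BoseEinsteinCondensation.Theorems.BECThomsonPrinciplePeriodicToDirichletDefs
import Literature.MathematicalPhysics.QuantumManyBody.BoseGasDiluteEnergyFloor

/-!
# Route `BECThomsonPrinciple`, crux `PeriodicToDirichlet` (stmt-AtomisticToContinuum-9483),
# line `reward-pays-the-wall` — stub `stub_rewardSandwich : RewardSandwich`

Griffiths' variational sandwich for the number-conserving rewarded Dirichlet functional
`R_λ(Ψ) = ⟨Ψ, HΨ⟩ + λ (N - n_φ(Ψ))` of the line's `Defs` file
(`BECThomsonPrinciplePeriodicToDirichletDefs`): for every repulsive finite-range `v` there is a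
density cap `ρ₂ > 0` such that for `0 < ρ < ρ₂`, `0 < c ≤ 1`, the rewarded upper bound
`RewardedUpperBound v ρ c` (eventually `F^D(λ) ≤ N (e₀ + θ + λ (1 - c + θ))` for all `θ > 0`)
forces, at every reward `λ > 0`, flat-mode condensation `n_φ ≥ (c/2) N` of the `δ`-near-minimisers
of `R_λ` (`RewardedBoxBECAt v ρ λ (c/2)`), with `δ = λ c N / 8`.

Only the reward side crosses the Dirichlet wall; the floor is the EXACT Dirichlet thermodynamic
limit `E₀^D(N, L_N)/N → e₀(ρ) < ∞` below the cap (Ruelle 1969 §3.5.11 (a); the tree's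
`exists_density_cap_tendsto_e0`, `eventually_mul_sub_le_toReal_of_groundStateEnergy_le` of
`BoseGasDiluteEnergyFloor.lean`).

References: Griffiths 1966 §II; LSSY 2005 §1.2 (1.17)–(1.19), Ch. 2 after (2.2), App. D
(D.15)–(D.19); Ruelle 1969 §3.5.11.
-/

noncomputable section

open MeasureTheory Filter
open scoped ENNReal NNReal

namespace Summit.AtomisticToContinuum.BoseEinsteinCondensation.RewardPaysTheWall

open Literature.MathematicalPhysics.QuantumManyBody.BoseGas

/-! ## The reward sandwich (registered stub `stub_rewardSandwich`)

Griffiths' variational argument (Griffiths 1966 §II; LSSY 2005 App. D (D.15)–(D.19) in the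
number-conserving costume of this line): only the REWARD side of the rewarded functional crosses
the Dirichlet wall, the floor is the exact Dirichlet thermodynamic limit
`E₀^D(N, L_N)/N → e₀(ρ) < ∞` below the density cap of `exists_density_cap_tendsto_e0`
(`BoseGasDiluteEnergyFloor.lean`; Ruelle 1969 §3.5.11 (a)). -/

/-- **The reward sandwich** (registered stub of the line `reward-pays-the-wall`; Griffiths 1966
§II variational argument against the exact Dirichlet floor). For a `δ`-near-minimiser `Ψ` of
`R_λ`, `⟨Ψ,HΨ⟩ + λ (N - n_φ(Ψ)) = R_λ(Ψ) ≤ F^D(λ) + δ ≤ N (e₀ + θ + λ (1 - c + θ)) + δ` eventually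
(`RewardedUpperBound`), while `⟨Ψ,HΨ⟩ ≥ E₀^D ≥ N (e₀ - ε)` eventually (Dirichlet thermodynamic
limit, `e₀ < ∞` below the cap of `exists_density_cap_tendsto_e0`); with `θ = min (c/8) (λc/8)`,
`ε = λc/8`, `δ = λcN/8` this forces `n_φ(Ψ) ≥ (c/2) N` (the subtraction `N - n_φ` is truncated, so
the case `n_φ ≥ N` is trivial and `n_φ ≤ N` is never needed). [folklore] -/
theorem stub_rewardSandwich : RewardSandwich := by
  intro v hv
  obtain ⟨ρ₂, hρ₂, hcap⟩ := exists_density_cap_tendsto_e0 v hv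
  refine ⟨ρ₂, hρ₂, fun ρ hρ hρlt c hc hc1 hU lam hlam => ?_⟩
  obtain ⟨he, hT, -⟩ := hcap ρ hρ hρlt
  -- the constants `θ = min (c/8) (λc/8)`, `ε = λc/8`
  obtain ⟨θ, hθ, hθ1, hθ2⟩ : ∃ θ : ℝ, 0 < θ ∧ θ ≤ c / 8 ∧ θ ≤ lam * c / 8 :=
    ⟨min (c / 8) (lam * c / 8), lt_min (by positivity) (by positivity), min_le_left _ _,
      min_le_right _ _⟩
  have hε : 0 < lam * c / 8 := by positivity
  unfold RewardedBoxBECAt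
  filter_upwards [hU θ hθ lam hlam.le,
    eventually_mul_sub_le_toReal_of_groundStateEnergy_le he hT hε, eventually_gt_atTop 0]
    with N hUN hfloor hN0
  have hN : (0 : ℝ) < N := Nat.cast_pos.2 hN0
  have hA : (0 : ℝ) ≤ N * ((e0 v ρ).toReal + θ + lam * (1 - c + θ)) := by
    have : 0 ≤ (e0 v ρ).toReal := ENNReal.toReal_nonneg
    have : 0 ≤ lam * (1 - c + θ) := mul_nonneg hlam.le (by linarith)
    positivity
  refine ⟨ENNReal.ofReal (lam * c * N / 8), ENNReal.ofReal_pos.2 (by positivity), fun Ψ hΨ => ?_⟩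
  -- Case `n_φ ≥ N`: trivial since `c/2 ≤ 1`
  rcases le_or_gt (N : ℝ≥0∞) (occupation N (boxConstantMode (sideLength ρ N)) Ψ.ψ) with hNn | hnN
  · calc ENNReal.ofReal (c / 2 * N) ≤ ENNReal.ofReal (N : ℝ) :=
          ENNReal.ofReal_le_ofReal (by nlinarith)
      _ = (N : ℝ≥0∞) := ENNReal.ofReal_natCast N
      _ ≤ _ := hNn
  -- Case `n_φ < N`: everything is finite; pass to `ℝ`
  have hn_top : occupation N (boxConstantMode (sideLength ρ N)) Ψ.ψ ≠ ⊤ := hnN.ne_top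
  have hsub : ((N : ℝ≥0∞) - occupation N (boxConstantMode (sideLength ρ N)) Ψ.ψ).toReal =
      N - (occupation N (boxConstantMode (sideLength ρ N)) Ψ.ψ).toReal := by
    rw [ENNReal.toReal_sub_of_le hnN.le (ENNReal.natCast_ne_top N), ENNReal.toReal_natCast]
  have hup : energy v Ψ + ENNReal.ofReal lam *
        ((N : ℝ≥0∞) - occupation N (boxConstantMode (sideLength ρ N)) Ψ.ψ) ≤
      ENNReal.ofReal (N * ((e0 v ρ).toReal + θ + lam * (1 - c + θ)) + lam * c * N / 8) :=
    calc energy v Ψ + ENNReal.ofReal lam *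
          ((N : ℝ≥0∞) - occupation N (boxConstantMode (sideLength ρ N)) Ψ.ψ)
        = rewardedEnergy v lam Ψ := rfl
      _ ≤ rewardedInf v lam N (sideLength ρ N) + ENNReal.ofReal (lam * c * N / 8) := hΨ
      _ ≤ ENNReal.ofReal (N * ((e0 v ρ).toReal + θ + lam * (1 - c + θ))) +
            ENNReal.ofReal (lam * c * N / 8) := add_le_add hUN le_rfl
      _ = ENNReal.ofReal (N * ((e0 v ρ).toReal + θ + lam * (1 - c + θ)) + lam * c * N / 8) :=
          (ENNReal.ofReal_add hA (by positivity)).symm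
  have htop : energy v Ψ + ENNReal.ofReal lam *
      ((N : ℝ≥0∞) - occupation N (boxConstantMode (sideLength ρ N)) Ψ.ψ) ≠ ⊤ :=
    ne_top_of_le_ne_top ENNReal.ofReal_ne_top hup
  have hEtop : energy v Ψ ≠ ⊤ := (ENNReal.add_ne_top.1 htop).1
  have hRtop : ENNReal.ofReal lam *
      ((N : ℝ≥0∞) - occupation N (boxConstantMode (sideLength ρ N)) Ψ.ψ) ≠ ⊤ :=
    (ENNReal.add_ne_top.1 htop).2
  -- the sandwich in `ℝ`: reward side `≤`, floor side `≥`
  have hup' : (energy v Ψ).toReal +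
        lam * (N - (occupation N (boxConstantMode (sideLength ρ N)) Ψ.ψ).toReal) ≤
      N * ((e0 v ρ).toReal + θ + lam * (1 - c + θ)) + lam * c * N / 8 := by
    have h := ENNReal.toReal_mono ENNReal.ofReal_ne_top hup
    rwa [ENNReal.toReal_add hEtop hRtop, ENNReal.toReal_mul, ENNReal.toReal_ofReal hlam.le, hsub,
      ENNReal.toReal_ofReal (add_nonneg hA (by positivity))] at h
  have hfloor' : (N : ℝ) * ((e0 v ρ).toReal - lam * c / 8) ≤ (energy v Ψ).toReal :=
    hfloor _ (groundStateEnergy_le_energy v Ψ) hEtop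
  have h1 : (N : ℝ) * θ ≤ N * (lam * c / 8) := mul_le_mul_of_nonneg_left hθ2 hN.le
  have h2 : (N : ℝ) * lam * θ ≤ N * lam * (c / 8) :=
    mul_le_mul_of_nonneg_left hθ1 (by positivity)
  have hkey : lam * (c / 2 * N) ≤
      lam * (occupation N (boxConstantMode (sideLength ρ N)) Ψ.ψ).toReal := by
    nlinarith [hup', hfloor', h1, h2]
  calc ENNReal.ofReal (c / 2 * N)
      ≤ ENNReal.ofReal (occupation N (boxConstantMode (sideLength ρ N)) Ψ.ψ).toReal :=
        ENNReal.ofReal_le_ofReal (le_of_mul_le_mul_left hkey hlam)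
    _ = _ := ENNReal.ofReal_toReal hn_top

end Summit.AtomisticToContinuum.BoseEinsteinCondensation.RewardPaysTheWall

end
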